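import Literature.AlgebraicGeometry.Motives.ComplexPointsManifold
import Literature.NumberTheory.Transcendental.DeRhamTheoremProofs
import HarnessLib

/-!
# `X(ℂ)` is locally compact, σ-compact and paracompact for `X` smooth over `ℂ`; second countability along open immersions

Layer `Literature/AlgebraicGeometry/Motives`, namespace `Literature.AlgebraicGeometry.Motives.ComplexPoints`.  THEOREMS ONLY.
For a scheme `X` smooth of relative dimension `n` and locally of finite type over `ℂ`, the complex points `X(ℂ)` with the analytic
topology are a topological `2n`-manifold (★ `ComplexPoints.chartedSpace`, Serre GAGA §2 n° 5–6), hence LOCALLY COMPACT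
(`locallyCompactSpace_of_smooth`); if moreover `X(ℂ)` is second countable (e.g. `X` quasi-compact: an open immersion into a proper
`ℂ`-scheme, `secondCountableTopology_of_isOpenImmersion`, SGA1 XII Prop. 3.1/3.2) it is σ-COMPACT and — being Hausdorff for `X` separated
(★ `ComplexPoints.t2Space_of_isSeparated`) — PARACOMPACT (`paracompactSpace_of_smooth`; Mathlib: locally compact + σ-compact + T₂ ⇒
paracompact).  Paracompactness of `X(ℂ)` is the standing hypothesis of the topological first Chern class on `X(ℂ)`
(★ `CharacteristicClasses.ComplexVectorBundle.firstChernClass`, cell `hodgecm-mathlib` (U)-lane leaf (T2) item (L0)); HC_CM is proved only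
modulo the 7 printed citations until rung 0 closes, and this file discharges none of them.

## References
* [SerreGAGA1956] J.-P. Serre, GAGA, Ann. Inst. Fourier 6 (1956), §2 n° 5 Prop. 2, n° 6.
* [SGA1] A. Grothendieck, SGA 1, Exp. XII Prop. 3.1, Prop. 3.2 (topological properties of `X^an`).
-/

set_option autoImplicit false

noncomputable section

open CategoryTheory AlgebraicGeometry Topology

namespace Literature.AlgebraicGeometry.Motives.ComplexPoints

/-- **`X(ℂ)` is locally compact** for `X` smooth of relative dimension `n`, locally of finite type over `ℂ` (a topological manifold on
`ℝ^{2n}`, ★ `ComplexPoints.chartedSpace`). [cite: SGA1, Exp. XII Prop. 3.1] [cite: SerreGAGA1956, §2 n°5 Prop. 2 and n°6] -/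
theorem locallyCompactSpace_of_smooth (X : SchemeOver ℂ) (n : ℕ) [LocallyOfFiniteType X.hom] [SmoothOfRelativeDimension n X.hom] :
    LocallyCompactSpace (ComplexPoints X) :=
  letI := ComplexPoints.chartedSpace X n
  Literature.NumberTheory.Transcendental.locallyCompactSpace_of_chartedSpace (E := EuclideanSpace ℝ (Fin (2 * n))) (ComplexPoints X)

/-- **`X(ℂ)` is σ-compact** for `X` smooth over `ℂ` with `X(ℂ)` second countable (locally compact + second countable).
[cite: SGA1, Exp. XII Prop. 3.2] -/
theorem sigmaCompactSpace_of_smooth (X : SchemeOver ℂ) (n : ℕ) [LocallyOfFiniteType X.hom] [SmoothOfRelativeDimension n X.hom]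
    [SecondCountableTopology (ComplexPoints X)] : SigmaCompactSpace (ComplexPoints X) :=
  haveI := locallyCompactSpace_of_smooth X n
  inferInstance

/-- **`X(ℂ)` is paracompact** for `X` smooth over `ℂ` with `X(ℂ)` Hausdorff and second countable (locally compact + σ-compact + T₂;
Mathlib). [cite: SGA1, Exp. XII Prop. 3.1] -/
theorem paracompactSpace_of_smooth (X : SchemeOver ℂ) (n : ℕ) [LocallyOfFiniteType X.hom] [SmoothOfRelativeDimension n X.hom]
    [T2Space (ComplexPoints X)] [SecondCountableTopology (ComplexPoints X)] : ParacompactSpace (ComplexPoints X) :=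
  haveI := locallyCompactSpace_of_smooth X n
  inferInstance

/-- **Second countability along an open immersion into a proper scheme**: if `j : X ⟶ P` is an open immersion of `ℂ`-schemes and
`P` is proper over `ℂ`, then `X(ℂ)` is second countable (`P(ℂ)` is second countable, ★ `secondCountableTopology_of_compactSpace_holds`,
and `j(ℂ)` is an open embedding, ★ `AlgPoints.isOpenEmbedding_map_holds`). [cite: SGA1, Exp. XII Prop. 3.1 and Prop. 3.2] -/
theorem secondCountableTopology_of_isOpenImmersion (X : SchemeOver ℂ) {P : SchemeOver ℂ} (j : X ⟶ P) [IsOpenImmersion j.left]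
    [IsProper P.hom] :
    SecondCountableTopology (ComplexPoints X) := by
  haveI : CompactSpace P.left := QuasiCompact.compactSpace_of_compactSpace P.hom
  haveI := ComplexPoints.secondCountableTopology_of_compactSpace_holds P
  exact (AlgPoints.isOpenEmbedding_map_holds j).isEmbedding.secondCountableTopology

/-- **`X(ℂ)` is paracompact for `X` smooth and separated over `ℂ` admitting an open immersion into a proper `ℂ`-scheme** (e.g. `X`
quasi-projective). [cite: SGA1, Exp. XII Prop. 3.1 and Prop. 3.2] -/
theorem paracompactSpace_of_isOpenImmersion (X : SchemeOver ℂ) (n : ℕ) [LocallyOfFiniteType X.hom] [SmoothOfRelativeDimension n X.hom]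
    [IsSeparated X.hom] {P : SchemeOver ℂ} (j : X ⟶ P) [IsOpenImmersion j.left] [IsProper P.hom] :
    ParacompactSpace (ComplexPoints X) :=
  haveI := ComplexPoints.t2Space_of_isSeparated (X := X)
  haveI := secondCountableTopology_of_isOpenImmersion X j
  paracompactSpace_of_smooth X n

end Literature.AlgebraicGeometry.Motives.ComplexPoints

end
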